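import Mathlib
import HarnessLib
import Summits.AtomisticToContinuum.FouriersLaw.Theses.BoundaryEscapeDeficit

/-!
# Crux-strategist s2 sketch for `BoundaryEscapeDeficit.HalfChainTailLaw` (stmt-AtomisticToContinuum-12235):
# typed `## Strengthen` / `## Transfer` candidates (defs only; every decl elaborates, nothing is claimed proved)

Notation as in the route file (`let P / K / θ` VERBATIM): `K_M(u) = ⟨p₀² − T, P_u(p₀² − T)⟩_{μ_T^M}`, `θ_M(t) = (γ/T²)∫₀ᵗ K_M`.
Laplace side: `R_M(λ) := ∫₀^∞ e^{−λu} K_M(u) du` (`= ⟨b, (λ − L_M)⁻¹ b⟩_{L²(μ_T^M)}`, `b = p₀² − T`) and the LAPLACE DEFICIT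
`D_M(λ) := λ∫₀^∞ e^{−λt}(1 − θ_M(t)) dt = 1 − (γ/T²) R_M(λ)` (integration by parts, `θ_M(0) = 0`, `|θ_M(t)| ≤ 2γt`).

* `LaplacePassivity` (S⁺_P, FREE, phonon-true, N-uniform): `(γ/T²) R_M(λ) ≤ 2γ/(λ + 2γ)` for every `λ > 0`, every `M ≥ 1` —
  the chain never pumps energy INTO the thermostatted site in the Laplace order (`θ_M ≼ 1 − e^{−2γt}`).  Reason: `b` is an
  eigenfunction of the bath part `S` of the generator (`S b = −2γ b`), the Hamiltonian part `A` is skew on `L²(μ_T)`, and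
  `⟨f, (λ − S − A)⁻¹ f⟩ ≤ ⟨f, (λ − S)⁻¹ f⟩ = ‖b‖²/(λ + 2γ) = 2T²/(λ + 2γ)`.  Its `λ = 0` endpoint is the LANDED `E_N ≥ 0`
  (`escapeDeficit_nonneg`, p139693).  The PASSIVITY DEFECT has the exact form `2T²/(λ+2γ) − R_M(λ) = ⟨A u_λ, (λ − S)⁻¹ A u_λ⟩`,
  `u_λ = (λ − L_M)⁻¹ b`; `SumRule` ⟺ the half-line defect vanishes at `λ = 0`; the crux ⟺ it vanishes exactly at rate `√λ`.
* `LaplaceTailLaw` (S⁺_Λ / transfer C⁺): `c√λ ≤ D_M(λ) ≤ C√λ` for `0 < λ ≤ λ₀`, eventually in `M` — the crux on the Laplace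
  side (implied by the crux by Abelian estimates; implies it back given `EventualMonotone`, elementary Tauberian argument for
  monotone functions with two-sided bounds).
* `EventualMonotone` (the Tauberian regularity piece): `θ_M(a) ≤ θ_M(b)` for `u₀ ≤ a ≤ b`, eventually in `M`
  (`∫ₐᵇ K_M ≥ 0`: the hydrodynamic return tail of the boundary autocorrelation is eventually nonnegative).
* `KernelTwoSided` (S⁺_K, the derivative form, strictly stronger than the crux given `SumRule`):
  `c u^{−3/2} ≤ K_M(u) ≤ C u^{−3/2}` on `[a, b]` for `u₀ ≤ a ≤ b`, eventually in `M` — the first-return law for the boundary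
  kinetic-energy autocorrelation itself.

See `STRATEGY-CENSUS.md` §Strengthen / §Transfer for why none of these buys leverage for THIS step.
-/

noncomputable section

namespace Summit.AtomisticToContinuum.FouriersLaw.Cruxes.HalfChainTailLaw.StrategistS2

open Filter Topology MeasureTheory

/-- **S⁺_P — Laplace passivity** (free, N-uniform, phonon-true): for `pinnedChain ω₂ lam β γ` (all `> 0`), `T > 0`, every
`M ≥ 1` and every `λ > 0`, `u ↦ e^{−λu} K_M(u)` is integrable on `(0, ∞)` and `(γ/T²)∫₀^∞ e^{−λu} K_M(u) du ≤ 2γ/(λ + 2γ)`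
(resolvent domination `⟨b,(λ−L)⁻¹b⟩ ≤ ⟨b,(λ−S)⁻¹b⟩`, `S b = −2γ b`, `‖b‖² = 2T²`).  Fixed-`M` `L²(μ_T)` semigroup technology;
the `λ → 0` endpoint is the landed `escapeDeficit_nonneg`. -/
def LaplacePassivity : Prop :=
  ∀ ω₂ lam β γ : ℝ, 0 < ω₂ → 0 < lam → 0 < β → 0 < γ → ∀ T : ℝ, 0 < T → (let P := Literature.MathematicalPhysics.KineticTheory.HeatConduction.pinnedChain ω₂ lam β γ; let K : ℕ → ℝ → ℝ := fun N u => if h : 0 < N then ∫ z, ((z.2 ⟨0, h⟩) ^ 2 - T) * (∫ y, ((y.2 ⟨0, h⟩) ^ 2 - T) ∂(P.transitionKernel N T T u.toNNReal z)) ∂(P.gibbsMeasure N T) else 0; ∀ M : ℕ, 0 < M → ∀ s : ℝ, 0 < s → MeasureTheory.IntegrableOn (fun u : ℝ => Real.exp (-s * u) * K M u) (Set.Ioi 0) ∧ γ / T ^ 2 * ∫ u in Set.Ioi (0 : ℝ), Real.exp (-s * u) * K M u ≤ 2 * γ / (s + 2 * γ))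

/-- **S⁺_Λ — the crux on the Laplace side** (transfer `C⁺`): there are `c, C, λ₀ > 0` with: for every `0 < λ ≤ λ₀`,
eventually in `M`, `c√λ ≤ 1 − (γ/T²)∫₀^∞ e^{−λu} K_M(u) du ≤ C√λ` (the Laplace deficit `D_M(λ) = λ·𝓛[1 − θ_M](λ)` vanishes
at zero frequency exactly at rate `√λ`: the `√λ` law of the passivity defect / the Warburg law of the contact). -/
def LaplaceTailLaw : Prop :=
  ∀ ω₂ lam β γ : ℝ, 0 < ω₂ → 0 < lam → 0 < β → 0 < γ → ∀ T : ℝ, 0 < T → (let P := Literature.MathematicalPhysics.KineticTheory.HeatConduction.pinnedChain ω₂ lam β γ; let K : ℕ → ℝ → ℝ := fun N u => if h : 0 < N then ∫ z, ((z.2 ⟨0, h⟩) ^ 2 - T) * (∫ y, ((y.2 ⟨0, h⟩) ^ 2 - T) ∂(P.transitionKernel N T T u.toNNReal z)) ∂(P.gibbsMeasure N T) else 0; ∃ c C s₀ : ℝ, 0 < c ∧ 0 < s₀ ∧ ∀ s : ℝ, 0 < s → s ≤ s₀ → ∀ᶠ M : ℕ in Filter.atTop, c * Real.sqrt s ≤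 1 - γ / T ^ 2 * ∫ u in Set.Ioi (0 : ℝ), Real.exp (-s * u) * K M u ∧ 1 - γ / T ^ 2 * ∫ u in Set.Ioi (0 : ℝ), Real.exp (-s * u) * K M u ≤ C * Real.sqrt s)

/-- **Tauberian regularity piece — eventual monotonicity of the boundary thermalisation curve**: there is `u₀ > 0` with:
for all `u₀ ≤ a ≤ b`, eventually in `M`, `θ_M(a) ≤ θ_M(b)` (`∫ₐᵇ K_M ≥ 0`: the return tail of the boundary kinetic-energy
autocorrelation is eventually nonnegative).  With `LaplaceTailLaw` it gives the crux back (elementary Tauberian argument for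
monotone functions with two-sided bounds). -/
def EventualMonotone : Prop :=
  ∀ ω₂ lam β γ : ℝ, 0 < ω₂ → 0 < lam → 0 < β → 0 < γ → ∀ T : ℝ, 0 < T → (let P := Literature.MathematicalPhysics.KineticTheory.HeatConduction.pinnedChain ω₂ lam β γ; let K : ℕ → ℝ → ℝ := fun N u => if h : 0 < N then ∫ z, ((z.2 ⟨0, h⟩) ^ 2 - T) * (∫ y, ((y.2 ⟨0, h⟩) ^ 2 - T) ∂(P.transitionKernel N T T u.toNNReal z)) ∂(P.gibbsMeasure N T) else 0; let θ : ℕ → ℝ → ℝ := fun N t => γ / T ^ 2 * ∫ u in (0 : ℝ)..t, K N u; ∃ u₀ : ℝ, 0 < u₀ ∧ ∀ a b : ℝ, u₀ ≤ a → a ≤ b → ∀ᶠ M : ℕ in Filter.atTop, θ M a ≤ θ M b)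

/-- **S⁺_K — the derivative (first-return) form, strictly stronger than the crux given `SumRule`**: there are `c, C, u₀ > 0`
with: for all `u₀ ≤ a ≤ b`, eventually in `M`, `c·u^{−3/2} ≤ K_M(u) ≤ C·u^{−3/2}` for every `u ∈ [a, b]` — the boundary
kinetic-energy autocorrelation itself obeys the two-sided first-return law of one-dimensional diffusion.  FALSE at the harmonic
corner on the lower side (`K^harm ≍ u⁻³cos²`), true there on the upper side. -/
def KernelTwoSided : Prop :=
  ∀ ω₂ lam β γ : ℝ, 0 < ω₂ → 0 < lam → 0 < β → 0 < γ → ∀ T : ℝ, 0 < T → (let P := Literature.MathematicalPhysics.KineticTheory.HeatConduction.pinnedChain ω₂ lam β γ; let K : ℕ → ℝ → ℝ := fun N u => if h : 0 < N then ∫ z, ((z.2 ⟨0, h⟩) ^ 2 - T) * (∫ y, ((y.2 ⟨0, h⟩) ^ 2 - T) ∂(P.transitionKernel N T T u.toNNReal z)) ∂(P.gibbsMeasure N T) else 0; ∃ c C u₀ : ℝ, 0 < c ∧ 0 < u₀ ∧ ∀ a b : ℝ, u₀ ≤ a → a ≤ b → ∀ᶠ M : ℕ in Filter.atTop, ∀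 u : ℝ, u ∈ Set.Icc a b → c / (u * Real.sqrt u) ≤ K M u ∧ K M u ≤ C / (u * Real.sqrt u))

/-- The four candidate statements elaborate (a trivial kernel check that the `let`-vocabulary is the route's). -/
example : LaplacePassivity → LaplaceTailLaw → EventualMonotone → KernelTwoSided → True := fun _ _ _ _ => trivial

end Summit.AtomisticToContinuum.FouriersLaw.Cruxes.HalfChainTailLaw.StrategistS2

end
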